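import Literature.Computability.QuantumComplexity.PauliParseval
import Literature.Analysis.Approximation.MarkovInequality
import Mathlib.Analysis.Calculus.MeanValue
import Mathlib.Analysis.Matrix.Spectrum
import Mathlib.Analysis.InnerProductSpace.PiL2
import Mathlib.Algebra.Order.Chebyshev
import HarnessLib

/-!
# Pauli sums are Frobenius-fat — the typed residue of the sample-and-query (Frobenius)
# currency on `m`-term Pauli Hamiltonians: a degree floor for the SQ normal form

The dequantized singular-value-transformation shelf (Chia–Gilyén–Li–Lin–Tang–Wang
[ChiaEtAl2022, §3.3 Thm 3.4], typed in this directory as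
`SampleQuery.even_singular_value_transformation_sample_complexity` and, with explicit degree
dependence, `SampleQuery.EvenPolySVT.even_polynomial_svt`) works in the FROBENIUS currency: the
input is normalised to `‖A‖_F ≤ 1` and every cost bound is a polynomial in the degree `d` of the
applied polynomial and in `‖A‖_F`. The literature records the consequence for Hamiltonians only
in prose — "the runtimes of [CGLLTW20, JLS20] depend polynomially on the Frobenius norm of `A`,
which is small when the rank is small" [GharibianLegall2022, §1 footnote]; "1-to-4 [gap] for
`‖A‖_F` (which we think of as square root of stable rank `‖A‖_F²/‖A‖²`)" [BakshiTang2023, §1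
pp. 8–9]; the one QUANTIFIED printed form is the efficiency condition
`‖H‖_F² − tr(H)²/N ≤ O(polylog N)` of Rudi et al. [RudiEtAl2018, Cor 2] for Nyström-dequantized
Hamiltonian simulation. This file types the residue with constants, for `m`-term Pauli sums
`H = Σ_{S∈T} c(S) σ_S` on `n` qubits (`#T = m`, real `c`, Pauli 1-norm `Λ = Σ_{S∈T}|c(S)|` — the
energy unit of the guided-local-Hamiltonian normalisations, cf. `pauliOneNorm`):

* `abs_derivative_le_of_bulk`, `bulk_resolution_le` — `deg p ≤ d`, `|p| ≤ 1` on `[-1,1]` ⇒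
  `|p'| ≤ 2d/√3` and `|p(x₁) − p(x₂)| ≤ (2d/√3)|x₁ − x₂|` on the bulk `[-½, ½]`
  (tree `bernstein_inequality`);
* `sq_eigenvalue_le_frobSq`, `eigenvalue_div_mem_bulk` — `λᵢ(H)² ≤ ‖H‖_F²`; the normal form
  `A = H/(2‖H‖_F)` has its spectrum in `[-½, ½]`;
* `frobenius_normal_form_degree_floor` — ANY Hermitian `H`: a margin
  `γ ≤ |p(μᵢ/2‖H‖_F) − p(μⱼ/2‖H‖_F)|` forces `√3·γ·‖H‖_F ≤ d·|μᵢ − μⱼ|`;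
* `frobSq_pauliSum` — `‖H_c‖_F² = 2ⁿ · Σ_S c(S)²` (tree Parseval `sum_norm_pauliCoeff_sq`);
* `pauliOneNorm_sq_le_card_mul_frobSq` — `2ⁿ · Λ² ≤ m · ‖H_c‖_F²` (stable rank `≥ 2ⁿ/m`);
* `abs_eigenvalue_pauliSum_le` — `|μᵢ(H_c)| ≤ Σ_S |c(S)| = Λ` (so `srank(H_c) ≥ 2ⁿ/m` literally);
* **`pauliSum_degree_floor`** — `√3 · γ · √(2ⁿ/m) · Λ ≤ d · |μᵢ − μⱼ|`;
* **`pauliSum_degree_floor_relative`** — `|μᵢ − μⱼ| ≤ ε·Λ` ⇒ `√3 · γ · √(2ⁿ/m) ≤ d · ε`,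
  i.e. **`d ≥ √3γ√(2ⁿ/m)/ε`**;
* **`pauliSum_no_scaling_escape`** — for EVERY scaling `A = H/λ`, `λ > 0`:
  `min(½, (√3/2)γ/ε) · √(2ⁿ/m) ≤ d · ‖A‖_F` (bulk: Bernstein floor; edge: `λ < 2Λ` and the
  Frobenius factor alone is `> √(2ⁿ/m)/2`) — the product `d‖A‖_F` entering the thresholds as
  `(d‖A‖_F)⁴` is exponential in `n` whatever the normalisation;
* `sample_threshold_floor_display` — under the floor `d ≥ √3γ√(2ⁿ/m)/ε` the normalised even-SVT
  sample threshold `8φ²d⁴ℓ/ε'²` is `≥ 72φ²γ⁴4ⁿℓ/(m²ε⁴ε'²)`.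

READING. At fixed RELATIVE precision `ε` (eigenvalues `εΛ`-close, the guided-local-Hamiltonian
promise scale) any polynomial of the Frobenius normal form that separates them by a constant
margin has degree `≥ √3γ√(2ⁿ/m)/ε` — exponential in `n` for `m = poly(n)` Pauli terms; the
shelf's thresholds, monotone in `d‖A‖_F`, inherit a `(2ⁿ/m)²` factor in EVERY scaling
(`pauliSum_no_scaling_escape`; display for the normal form). Precision relative to the operator
norm is covered a fortiori (`‖H‖ ≤ Λ`, `abs_eigenvalue_pauliSum_le`). The constant `2/√3`
is Bernstein's weight `(1 − x²)^{-1/2}` at `|x| = ½`; the floor is tight up to that constant already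
at `d = 1` (`p = X` moves by exactly `|x₁ − x₂|`).

HONEST FRAMING. This is a floor on the PARAMETER `d` of the Frobenius-normal-form framework
(every result of the sample-and-query SVT shelf is stated for `‖A‖_F ≤ 1` and is monotone in
`d`), i.e. a typed statement of WHERE that currency cannot resolve the spectrum of a sparse Pauli
Hamiltonian at polynomial degree. It is NOT a lower bound against arbitrary classical algorithms
with sample-and-query access (cf. the SQ query floors typed elsewhere in this directory), it
says nothing about guiding states, and it is silent on BQP-hardness (the
`GharibianLegall2022` Thm 2 side is untouched and not restated). Nothing here proves or refutes
quantum advantage; no algorithm, oracle or sampler is constructed.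

## References

* [ChiaEtAl2022] N.-H. Chia, A. Gilyén, T. Li, H.-H. Lin, E. Tang, C. Wang, J. ACM 69 (2022) 33;
  arXiv:1910.06151, §3.3 Theorem 3.4 (normalisation `‖A‖_F = 1`, costs polynomial in `d`).
* [GharibianLegall2022] S. Gharibian, F. Le Gall, STOC 2022; arXiv:2111.09079, §1 (footnotes on
  the Frobenius-norm dependence of [CGLLTW20, JLS20] and of Rudi et al.).
* [BakshiTang2023] A. Bakshi, E. Tang, arXiv:2303.01492, §1 pp. 8–9 (stable rank `‖A‖_F²/‖A‖²`
  as the currency; "1-to-4 for `‖A‖_F`").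
* [RudiEtAl2018] A. Rudi et al., Quantum 4 (2020) 234; arXiv:1804.02484, Cor 2 (efficiency iff
  `‖H‖_F² − tr(H)²/N ≤ O(polylog N)`), p. 4 ("eigenvalues … in an exponentially small band").
* [KempeEtAl2010] J. Kempe, O. Regev, F. Unger, R. de Wolf, Quantum Inf. Comput. 10 (2010)
  361–376, §2 (Pauli basis, `Tr(SS') = 2ⁿ[S = S']`, Parseval).
* [Korneichuk1991] N. Korneichuk, *Exact Constants in Approximation Theory*, CUP 1991,
  Prop 3.5.7 (§3.5.4) (Bernstein's inequality).
* [HornJohnson2013] R. A. Horn, C. R. Johnson, *Matrix Analysis*, 2nd ed., Thm 5.6.9 (p. 438)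
  with the Frobenius matrix norm (§5.6 Example, p. 433): `|λ| ≤ ‖A‖_F`.
-/

noncomputable section

open Matrix Finset Polynomial

namespace Literature.Computability.QuantumComplexity

namespace PauliSumResidue

/-! ### §1 Bulk resolution of bounded polynomials (Bernstein) -/

/-- **Bernstein in the bulk**: if `deg p ≤ d` and `|p| ≤ 1` on `[-1,1]`, then `|p'(x)| ≤ 2d/√3`
for `|x| ≤ 1/2` (the tree's `bernstein_inequality` `|p'(x)|√(1-x²) ≤ d` with `√(1-x²) ≥ √3/2`).
[cite: Korneichuk1991, Prop 3.5.7 (§3.5.4), via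
`Literature.Analysis.Approximation.bernstein_inequality`] -/
theorem abs_derivative_le_of_bulk {d : ℕ} {p : ℝ[X]} (hp : p.degree ≤ d)
    (h1 : ∀ y ∈ Set.Icc (-1 : ℝ) 1, |p.eval y| ≤ 1) {x : ℝ}
    (hx : x ∈ Set.Icc (-(1 / 2) : ℝ) (1 / 2)) :
    |(derivative p).eval x| ≤ 2 * d / Real.sqrt 3 := by
  have hx1 : x ∈ Set.Icc (-1 : ℝ) 1 := ⟨by linarith [hx.1], by linarith [hx.2]⟩
  have hB := Literature.Analysis.Approximation.bernstein_inequality hp h1 hx1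
  -- `√(1 - x²) ≥ √3/2` on the bulk
  have hsq : (3 : ℝ) / 4 ≤ 1 - x ^ 2 := by nlinarith [hx.1, hx.2]
  have hroot : Real.sqrt 3 / 2 ≤ Real.sqrt (1 - x ^ 2) := by
    have : Real.sqrt 3 / 2 = Real.sqrt (3 / 4) := by
      rw [Real.sqrt_div (by norm_num : (0:ℝ) ≤ 3), show Real.sqrt 4 = 2 by
        rw [show (4:ℝ) = 2 ^ 2 by norm_num, Real.sqrt_sq (by norm_num : (0:ℝ) ≤ 2)]]
    rw [this]
    exact Real.sqrt_le_sqrt hsq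
  have h3 : 0 < Real.sqrt 3 := Real.sqrt_pos.mpr (by norm_num)
  have hpos : 0 < Real.sqrt 3 / 2 := by positivity
  have habs : 0 ≤ |(derivative p).eval x| := abs_nonneg _
  -- |p'| · (√3/2) ≤ |p'| · √(1-x²) ≤ d
  have hle : |(derivative p).eval x| * (Real.sqrt 3 / 2) ≤ d * 1 :=
    (mul_le_mul_of_nonneg_left hroot habs).trans hB
  rw [le_div_iff₀ h3]
  nlinarith [hle]

/-- **Bulk resolution floor**: a degree-`d` polynomial bounded by `1` on `[-1,1]` moves by at
most `(2d/√3)|x₁ - x₂|` between two points of the bulk `[-1/2, 1/2]` (mean value inequality).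
[cite: Korneichuk1991, Prop 3.5.7 (§3.5.4) (Bernstein) + mean value inequality] -/
theorem bulk_resolution_le {d : ℕ} {p : ℝ[X]} (hp : p.degree ≤ d)
    (h1 : ∀ y ∈ Set.Icc (-1 : ℝ) 1, |p.eval y| ≤ 1) {x₁ x₂ : ℝ}
    (hx₁ : x₁ ∈ Set.Icc (-(1 / 2) : ℝ) (1 / 2)) (hx₂ : x₂ ∈ Set.Icc (-(1 / 2) : ℝ) (1 / 2)) :
    |p.eval x₁ - p.eval x₂| ≤ 2 * d / Real.sqrt 3 * |x₁ - x₂| := by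
  have hderiv : ∀ z ∈ Set.Icc (-(1 / 2) : ℝ) (1 / 2),
      ‖deriv (fun t => p.eval t) z‖ ≤ 2 * d / Real.sqrt 3 := by
    intro z hz
    rw [Polynomial.deriv, Real.norm_eq_abs]
    exact abs_derivative_le_of_bulk hp h1 hz
  have h := (convex_Icc (-(1 / 2) : ℝ) (1 / 2)).norm_image_sub_le_of_norm_deriv_le
    (fun z _ => p.differentiableAt) hderiv hx₂ hx₁
  simpa [Real.norm_eq_abs] using h

/-- **Degree floor from a separation in the bulk**: if such a `p` separates `x₁, x₂ ∈ [-1/2,1/2]`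
by a margin `γ ≤ |p(x₁) - p(x₂)|`, then `(√3/2)·γ ≤ d·|x₁ - x₂|`. [cite: Korneichuk1991,
Prop 3.5.7 (§3.5.4) (Bernstein), contrapositive reading] -/
theorem degree_floor_of_separation {d : ℕ} {p : ℝ[X]} (hp : p.degree ≤ d)
    (h1 : ∀ y ∈ Set.Icc (-1 : ℝ) 1, |p.eval y| ≤ 1) {x₁ x₂ γ : ℝ}
    (hx₁ : x₁ ∈ Set.Icc (-(1 / 2) : ℝ) (1 / 2)) (hx₂ : x₂ ∈ Set.Icc (-(1 / 2) : ℝ) (1 / 2))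
    (hγ : γ ≤ |p.eval x₁ - p.eval x₂|) :
    Real.sqrt 3 / 2 * γ ≤ d * |x₁ - x₂| := by
  have h := hγ.trans (bulk_resolution_le hp h1 hx₁ hx₂)
  have h3 : 0 < Real.sqrt 3 := Real.sqrt_pos.mpr (by norm_num)
  -- multiply `γ ≤ (2d/√3)|x₁-x₂|` by `√3/2`
  have := mul_le_mul_of_nonneg_left h (le_of_lt (by positivity : (0:ℝ) < Real.sqrt 3 / 2))
  calc Real.sqrt 3 / 2 * γ ≤ Real.sqrt 3 / 2 * (2 * d / Real.sqrt 3 * |x₁ - x₂|) := this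
    _ = d * |x₁ - x₂| := by field_simp

/-! ### §2 Frobenius norm, eigenvalues in the bulk of the SQ normal form -/

variable {n : Type*} [Fintype n] [DecidableEq n]

/-- The Frobenius norm `‖H‖_F = √(Σ_{x,y} |H x y|²)` of a complex matrix (as a plain real
number; no norm instance is registered). [folklore] -/
def frobNorm (H : Matrix n n ℂ) : ℝ := Real.sqrt (∑ x, ∑ y, ‖H x y‖ ^ 2)

omit [DecidableEq n] in
/-- `‖H‖_F ≥ 0`. [folklore] -/
private theorem frobNorm_nonneg (H : Matrix n n ℂ) : 0 ≤ frobNorm H := Real.sqrt_nonneg _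

omit [DecidableEq n] in
/-- `‖H‖_F² = Σ |H x y|²`. [folklore] -/
private theorem frobNorm_sq (H : Matrix n n ℂ) : frobNorm H ^ 2 = ∑ x, ∑ y, ‖H x y‖ ^ 2 :=
  Real.sq_sqrt (by positivity)

omit [DecidableEq n] in
/-- `Σ |w x|² = re (w̄ · w)`. [folklore] -/
private theorem sum_norm_sq_eq_re (w : n → ℂ) : ∑ x, ‖w x‖ ^ 2 = (star w ⬝ᵥ w).re := by
  rw [dotProduct, Complex.re_sum]
  refine Finset.sum_congr rfl fun x _ => ?_
  rw [Pi.star_apply, Complex.star_def, Complex.conj_mul', ← Complex.ofReal_pow, Complex.ofReal_re]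

omit [DecidableEq n] in
/-- `w̄ · w = Σ |w x|²` as a complex number. [folklore] -/
private theorem star_dotProduct_self (w : n → ℂ) :
    star w ⬝ᵥ w = ((∑ x, ‖w x‖ ^ 2 : ℝ) : ℂ) := by
  rw [dotProduct, Complex.ofReal_sum]
  refine Finset.sum_congr rfl fun x _ => ?_
  rw [Pi.star_apply, Complex.star_def, Complex.conj_mul', Complex.ofReal_pow]

omit [DecidableEq n] in
/-- Cauchy–Schwarz for the Hermitian dot product: `|v̄ · w| ≤ √(Σ|v x|²) √(Σ|w x|²)`. [folklore] -/
private theorem norm_star_dotProduct_le (v w : n → ℂ) :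
    ‖star v ⬝ᵥ w‖ ≤ Real.sqrt (∑ x, ‖v x‖ ^ 2) * Real.sqrt (∑ x, ‖w x‖ ^ 2) := by
  calc ‖star v ⬝ᵥ w‖ = ‖∑ x, star (v x) * w x‖ := rfl
    _ ≤ ∑ x, ‖star (v x) * w x‖ := norm_sum_le _ _
    _ = ∑ x, ‖v x‖ * ‖w x‖ := Finset.sum_congr rfl fun x _ => by rw [norm_mul, norm_star]
    _ ≤ Real.sqrt (∑ x, ‖v x‖ ^ 2) * Real.sqrt (∑ x, ‖w x‖ ^ 2) :=
        Real.sum_mul_le_sqrt_mul_sqrt _ _ _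

/-- The chosen orthonormal eigenvectors have `Σ |v x|² = 1`. [folklore] -/
private theorem sum_norm_sq_eigenvectorBasis {H : Matrix n n ℂ} (hH : H.IsHermitian) (i : n) :
    ∑ y, ‖(⇑(hH.eigenvectorBasis i) : n → ℂ) y‖ ^ 2 = 1 := by
  have h1 : ‖hH.eigenvectorBasis i‖ = 1 := hH.eigenvectorBasis.orthonormal.1 i
  have h2 := EuclideanSpace.norm_sq_eq (hH.eigenvectorBasis i)
  rw [h1, one_pow] at h2
  exact h2.symm

/-- **Every eigenvalue is at most the Frobenius norm**: for a Hermitian `H` and any index `i`,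
`λᵢ² ≤ Σ_{x,y} |H x y|²` (Cauchy–Schwarz on `H v = λᵢ v` for the unit eigenvector `v`).
[cite: HornJohnson2013, Thm 5.6.9 (p0438) with the Frobenius matrix norm of §5.6 Example (p0433)] -/
theorem sq_eigenvalue_le_frobSq {H : Matrix n n ℂ} (hH : H.IsHermitian) (i : n) :
    hH.eigenvalues i ^ 2 ≤ ∑ x, ∑ y, ‖H x y‖ ^ 2 := by
  classical
  set v : n → ℂ := ⇑(hH.eigenvectorBasis i) with hv
  have hHv : H *ᵥ v = (hH.eigenvalues i : ℂ) • v := by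
    have := hH.mulVec_eigenvectorBasis i
    simpa [hv] using this
  -- `Σ |v y|² = 1`
  have hnorm1 : ∑ y, ‖v y‖ ^ 2 = 1 := by
    simpa [hv] using sum_norm_sq_eigenvectorBasis hH i
  -- `λᵢ² = Σ_x |(H v) x|²`
  have hlhs : hH.eigenvalues i ^ 2 = ∑ x, ‖(H *ᵥ v) x‖ ^ 2 := by
    rw [hHv]
    simp only [Pi.smul_apply, smul_eq_mul, norm_mul, mul_pow, Complex.norm_real,
      Real.norm_eq_abs, sq_abs]
    rw [← Finset.mul_sum, hnorm1, mul_one]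
  rw [hlhs]
  -- Cauchy–Schwarz row by row
  refine Finset.sum_le_sum fun x _ => ?_
  have hrow : ‖(H *ᵥ v) x‖ ≤ ∑ y, ‖H x y‖ * ‖v y‖ := by
    rw [Matrix.mulVec, dotProduct]
    exact (norm_sum_le _ _).trans (le_of_eq (Finset.sum_congr rfl fun y _ => norm_mul _ _))
  have hcs : (∑ y, ‖H x y‖ * ‖v y‖) ^ 2 ≤ (∑ y, ‖H x y‖ ^ 2) * ∑ y, ‖v y‖ ^ 2 :=
    Finset.sum_mul_sq_le_sq_mul_sq _ _ _
  rw [hnorm1, mul_one] at hcs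
  calc ‖(H *ᵥ v) x‖ ^ 2 ≤ (∑ y, ‖H x y‖ * ‖v y‖) ^ 2 :=
        pow_le_pow_left₀ (norm_nonneg _) hrow 2
    _ ≤ ∑ y, ‖H x y‖ ^ 2 := hcs

/-- **Bulk placement of the SQ normal form**: for Hermitian `H ≠ 0`, every eigenvalue `μ`
satisfies `μ/(2‖H‖_F) ∈ [-1/2, 1/2]` — the Frobenius-normalised matrix `A = H/(2‖H‖_F)`
(`‖A‖_F = 1/2 ≤ 1`, the standing normalisation of the sample-and-query SVT shelf) has its whole
spectrum in the bulk. [cite: HornJohnson2013, Thm 5.6.9 (p0438); ChiaEtAl2022, §3.3 Theorem 3.4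
(normalisation ‖A‖_F = 1)] -/
theorem eigenvalue_div_mem_bulk {H : Matrix n n ℂ} (hH : H.IsHermitian) (hF : 0 < frobNorm H)
    (i : n) : hH.eigenvalues i / (2 * frobNorm H) ∈ Set.Icc (-(1 / 2) : ℝ) (1 / 2) := by
  have hsq := sq_eigenvalue_le_frobSq hH i
  rw [← frobNorm_sq] at hsq
  have habs : |hH.eigenvalues i| ≤ frobNorm H := abs_le_of_sq_le_sq hsq (frobNorm_nonneg H)
  have h2 : 0 < 2 * frobNorm H := by positivity
  constructor
  · rw [le_div_iff₀ h2]; nlinarith [(abs_le.mp habs).1]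
  · rw [div_le_iff₀ h2]; nlinarith [(abs_le.mp habs).2]

/-- **General Frobenius-normal-form degree floor** (no Pauli structure yet): for Hermitian
`H ≠ 0`, a polynomial `p` with `deg p ≤ d`, `|p| ≤ 1` on `[-1,1]`, and two eigenvalues
`μᵢ, μⱼ` separated through the normal form `A = H/(2‖H‖_F)` by a margin
`γ ≤ |p(μᵢ/(2‖H‖_F)) - p(μⱼ/(2‖H‖_F))|`, one has `√3 · γ · ‖H‖_F ≤ d · |μᵢ - μⱼ|`:
resolving the spectrum at relative scale `|μᵢ - μⱼ|/‖H‖_F = ε/√srank` costs degree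
`≥ √3γ√srank/ε`. [cite: ChiaEtAl2022, §3.3 Theorem 3.4 (normalisation ‖A‖_F = 1, cost
polynomial in the degree d); BakshiTang2023, §1 pp. 8–9 (stable rank ‖A‖_F²/‖A‖² as the
currency); Korneichuk1991, Prop 3.5.7 (§3.5.4)] -/
theorem frobenius_normal_form_degree_floor {H : Matrix n n ℂ} (hH : H.IsHermitian)
    (hF : 0 < frobNorm H) {d : ℕ} {p : ℝ[X]} (hp : p.degree ≤ d)
    (h1 : ∀ y ∈ Set.Icc (-1 : ℝ) 1, |p.eval y| ≤ 1) (i j : n) {γ : ℝ}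
    (hγ : γ ≤ |p.eval (hH.eigenvalues i / (2 * frobNorm H)) -
      p.eval (hH.eigenvalues j / (2 * frobNorm H))|) :
    Real.sqrt 3 * γ * frobNorm H ≤ d * |hH.eigenvalues i - hH.eigenvalues j| := by
  have h := degree_floor_of_separation hp h1 (eigenvalue_div_mem_bulk hH hF i)
    (eigenvalue_div_mem_bulk hH hF j) hγ
  have h2 : 0 < 2 * frobNorm H := by positivity
  rw [← sub_div, abs_div, abs_of_pos h2] at h
  -- `√3/2 γ ≤ d |Δμ| / (2F)`  ⇒  `√3 γ F ≤ d |Δμ|`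
  rw [mul_div_assoc'] at h
  rw [le_div_iff₀ h2] at h
  nlinarith [h]

/-! ### §3 Pauli sums are Frobenius-fat -/

variable {ι : Type*} [Fintype ι] [DecidableEq ι]

/-- The Pauli sum `H_c = Σ_S c(S) · σ_S` with REAL coefficients `c` (a Hermitian `2ⁿ × 2ⁿ`
matrix on the register `ι → Bool`, `n = |ι|`); an `m`-term Pauli Hamiltonian is `H_c` with `c`
supported on `m` strings. [cite: GharibianLegall2022, §1 (local Hamiltonians as sums of Pauli
terms); Gall2024, §2.3 ((s, κ)-decomposition H = Σ H_i)] -/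
def pauliSum (c : (ι → Pauli) → ℝ) : Matrix (ι → Bool) (ι → Bool) ℂ :=
  ∑ S, ((c S : ℝ) : ℂ) • pauliString S

/-- `H_c` is Hermitian (real coefficients, Hermitian strings). [cite: KempeEtAl2010, §2 (Pauli
matrices are Hermitian)] -/
theorem isHermitian_pauliSum (c : (ι → Pauli) → ℝ) : (pauliSum c).IsHermitian := by
  unfold pauliSum Matrix.IsHermitian
  rw [Matrix.conjTranspose_sum]
  refine Finset.sum_congr rfl fun S _ => ?_
  rw [Matrix.conjTranspose_smul, conjTranspose_pauliString, Complex.star_def, Complex.conj_ofReal]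

/-- Pauli strings preserve `Σ |v x|²` (they are unitary: `σ_Sᴴ σ_S = σ_S² = 1`).
[cite: KempeEtAl2010, §2 (Pauli matrices are Hermitian involutions)] -/
private theorem sum_norm_sq_pauliString_mulVec (S : ι → Pauli) (v : (ι → Bool) → ℂ) :
    ∑ x, ‖(pauliString S *ᵥ v) x‖ ^ 2 = ∑ x, ‖v x‖ ^ 2 := by
  rw [sum_norm_sq_eq_re, sum_norm_sq_eq_re, Matrix.star_mulVec, Matrix.dotProduct_mulVec,
    Matrix.vecMul_vecMul, conjTranspose_pauliString, pauliString_mul_self, Matrix.vecMul_one]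

/-- **Eigenvalues of a Pauli sum are bounded by its Pauli 1-norm**: `|μᵢ(H_c)| ≤ Σ_S |c(S)|`
(`‖σ_S‖ = 1`; elementary form of `‖H‖ ≤ Σ‖Hᵢ‖`, the normalisation `Σ‖Hᵢ‖` of the guided
local Hamiltonian problem). [cite: Gall2024, §2.3 ((s, κ)-decomposition, ‖H‖ ≤ Σ‖Hᵢ‖);
KempeEtAl2010, §2] -/
theorem abs_eigenvalue_pauliSum_le (c : (ι → Pauli) → ℝ) (i : ι → Bool) :
    |(isHermitian_pauliSum c).eigenvalues i| ≤ ∑ S, |c S| := by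
  classical
  set hH := isHermitian_pauliSum c
  set v : (ι → Bool) → ℂ := ⇑(hH.eigenvectorBasis i) with hv
  have hHv : pauliSum c *ᵥ v = (hH.eigenvalues i : ℂ) • v := by
    have := hH.mulVec_eigenvectorBasis i
    simpa [hv] using this
  have hnorm1 : ∑ y, ‖v y‖ ^ 2 = 1 := by
    simpa [hv] using sum_norm_sq_eigenvectorBasis hH i
  have hvv : star v ⬝ᵥ v = 1 := by
    rw [star_dotProduct_self, hnorm1, Complex.ofReal_one]
  -- `μ = v̄ · H v = Σ_S c(S) · (v̄ · σ_S v)`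
  have hμ : (hH.eigenvalues i : ℂ) = ∑ S, ((c S : ℝ) : ℂ) * (star v ⬝ᵥ (pauliString S *ᵥ v)) := by
    have h1 : star v ⬝ᵥ (pauliSum c *ᵥ v) = (hH.eigenvalues i : ℂ) := by
      rw [hHv, dotProduct_smul, hvv, smul_eq_mul, mul_one]
    rw [← h1, pauliSum, Matrix.sum_mulVec, dotProduct_sum]
    refine Finset.sum_congr rfl fun S _ => ?_
    rw [Matrix.smul_mulVec, dotProduct_smul, smul_eq_mul]
  -- each `|v̄ · σ_S v| ≤ 1`
  have hS : ∀ S, ‖star v ⬝ᵥ (pauliString S *ᵥ v)‖ ≤ 1 := by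
    intro S
    have h := norm_star_dotProduct_le v (pauliString S *ᵥ v)
    rwa [sum_norm_sq_pauliString_mulVec, hnorm1, Real.sqrt_one, mul_one] at h
  have habs : |hH.eigenvalues i| = ‖(hH.eigenvalues i : ℂ)‖ := (Complex.norm_real _).symm
  rw [habs, hμ]
  refine (norm_sum_le _ _).trans (Finset.sum_le_sum fun S _ => ?_)
  rw [norm_mul, Complex.norm_real, Real.norm_eq_abs]
  exact mul_le_of_le_one_right (abs_nonneg _) (hS S)

/-- **Pauli coefficients of a Pauli sum**: `Tr(σ_S · H_c) = 2ⁿ · c(S)` (trace orthogonality).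
[cite: KempeEtAl2010, §2 (Tr(SS') = 2ⁿ[S = S'])] -/
theorem pauliCoeff_pauliSum (c : (ι → Pauli) → ℝ) (S : ι → Pauli) :
    pauliCoeff (pauliSum c) S = (2 : ℂ) ^ Fintype.card ι * c S := by
  unfold pauliSum
  rw [pauliCoeff_sum]
  simp_rw [pauliCoeff_smul, pauliCoeff_eq, trace_pauliString_mul_pauliString]
  simp [Finset.sum_ite_eq, mul_comm]

/-- **`‖H_c‖_F² = 2ⁿ Σ_S c(S)²`** (Parseval for the Pauli basis). [cite: KempeEtAl2010, §2
(Tr(δ²) = 2⁻ⁿ Σ_S δ̂(S)²), via `sum_norm_pauliCoeff_sq`] -/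
theorem frobSq_pauliSum (c : (ι → Pauli) → ℝ) :
    ∑ x, ∑ y, ‖pauliSum c x y‖ ^ 2 = (2 : ℝ) ^ Fintype.card ι * ∑ S, c S ^ 2 := by
  have hP := sum_norm_pauliCoeff_sq (pauliSum c)
  simp_rw [pauliCoeff_pauliSum, norm_mul, norm_pow, Complex.norm_ofNat, Complex.norm_real,
    Real.norm_eq_abs, mul_pow, sq_abs] at hP
  rw [← Finset.mul_sum] at hP
  -- hP : (2^n)^2 * Σ c² = 2^n * Σ‖H‖²
  have h2 : (0 : ℝ) < (2 : ℝ) ^ Fintype.card ι := by positivity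
  have : (2 : ℝ) ^ Fintype.card ι * ((2 : ℝ) ^ Fintype.card ι * ∑ S, c S ^ 2) =
      (2 : ℝ) ^ Fintype.card ι * ∑ x, ∑ y, ‖pauliSum c x y‖ ^ 2 := by
    rw [← mul_assoc, ← pow_two, ← hP]
  exact (mul_left_cancel₀ h2.ne' this).symm

/-- **Pauli sums are Frobenius-fat**: if `c` is supported on the `m` strings of `T` and
`Λ = Σ_{S∈T} |c(S)|` is the Pauli 1-norm, then `2ⁿ · Λ² ≤ m · ‖H_c‖_F²` (Parseval + Cauchy–
Schwarz) — i.e. `‖H_c‖_F ≥ √(2ⁿ/m) · Λ ≥ √(2ⁿ/m) · ‖H_c‖`: the stable rank of an `m`-term Pauli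
Hamiltonian is at least `2ⁿ/m`. [cite: KempeEtAl2010, §2 (Parseval); RudiEtAl2018, Cor 2 (the
printed quantified form `‖H‖_F² − tr(H)²/N ≤ O(polylog N)`); GharibianLegall2022, §1 footnote
("the runtimes of [CGLLTW20, JLS20] depend polynomially on the Frobenius norm of A, which is
small when the rank is small" — here quantified for Pauli sums)] -/
theorem pauliOneNorm_sq_le_card_mul_frobSq (c : (ι → Pauli) → ℝ) (T : Finset (ι → Pauli))
    (hT : ∀ S, S ∉ T → c S = 0) :
    (2 : ℝ) ^ Fintype.card ι * (∑ S ∈ T, |c S|) ^ 2 ≤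
      T.card * ∑ x, ∑ y, ‖pauliSum c x y‖ ^ 2 := by
  rw [frobSq_pauliSum]
  have hsupp : ∑ S, c S ^ 2 = ∑ S ∈ T, |c S| ^ 2 := by
    rw [← Finset.sum_subset (Finset.subset_univ T)]
    · exact Finset.sum_congr rfl fun S _ => (sq_abs _).symm
    · intro S _ hS; simp [hT S hS]
  rw [hsupp]
  have hcs : (∑ S ∈ T, |c S|) ^ 2 ≤ T.card * ∑ S ∈ T, |c S| ^ 2 := sq_sum_le_card_mul_sum_sq
  have h2 : (0 : ℝ) ≤ (2 : ℝ) ^ Fintype.card ι := by positivity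
  calc (2 : ℝ) ^ Fintype.card ι * (∑ S ∈ T, |c S|) ^ 2
      ≤ (2 : ℝ) ^ Fintype.card ι * (T.card * ∑ S ∈ T, |c S| ^ 2) :=
        mul_le_mul_of_nonneg_left hcs h2
    _ = T.card * ((2 : ℝ) ^ Fintype.card ι * ∑ S ∈ T, |c S| ^ 2) := by ring

/-- The same in norm form: `√(2ⁿ/m) · Λ ≤ ‖H_c‖_F`. [cite: KempeEtAl2010, §2 (Parseval);
RudiEtAl2018, Cor 2; GharibianLegall2022, §1 footnote] -/
theorem sqrt_mul_pauliOneNorm_le_frobNorm (c : (ι → Pauli) → ℝ) (T : Finset (ι → Pauli))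
    (hT : ∀ S, S ∉ T → c S = 0) :
    Real.sqrt ((2 : ℝ) ^ Fintype.card ι / T.card) * ∑ S ∈ T, |c S| ≤ frobNorm (pauliSum c) := by
  have hΛ : 0 ≤ ∑ S ∈ T, |c S| := Finset.sum_nonneg fun S _ => abs_nonneg _
  rcases Nat.eq_zero_or_pos T.card with h0 | hpos
  · simp [h0, frobNorm_nonneg]
  have hm : (0 : ℝ) < T.card := by exact_mod_cast hpos
  have h := pauliOneNorm_sq_le_card_mul_frobSq c T hT
  rw [← frobNorm_sq] at h
  -- (√(2ⁿ/m) Λ)² ≤ F²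
  have hsq : (Real.sqrt ((2 : ℝ) ^ Fintype.card ι / T.card) * ∑ S ∈ T, |c S|) ^ 2 ≤
      frobNorm (pauliSum c) ^ 2 := by
    rw [mul_pow, Real.sq_sqrt (by positivity), div_mul_eq_mul_div, div_le_iff₀ hm]
    linarith [h]
  exact (pow_le_pow_iff_left₀ (by positivity) (frobNorm_nonneg _) two_ne_zero).mp hsq

/-! ### §4 The residue, typed: degree floor for `m`-term Pauli sums in the SQ normal form -/

/-- **HEADLINE — Pauli-sum degree floor (absolute form).** Let `H = Σ_{S∈T} c(S) σ_S` be an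
`m`-term Pauli sum (`m = #T`, real coefficients, `H ≠ 0`), `Λ = Σ_{S∈T}|c(S)|` its Pauli 1-norm,
and `A = H/(2‖H‖_F)` its sample-and-query normal form (`‖A‖_F = 1/2`). If a polynomial `p` with
`deg p ≤ d`, `|p| ≤ 1` on `[-1,1]` separates two eigenvalues of `A` by a margin
`γ ≤ |p(μᵢ/(2‖H‖_F)) - p(μⱼ/(2‖H‖_F))|`, then
`√3 · γ · √(2ⁿ/m) · Λ ≤ d · |μᵢ - μⱼ|`.
So at fixed relative precision `|μᵢ - μⱼ| ≤ ε·Λ` the degree is `≥ √3γ√(2ⁿ/m)/ε` — exponential in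
the qubit number for `m = poly(n)` terms: the Frobenius currency of the SQ shelf cannot resolve
the spectrum of a sparse Pauli Hamiltonian at polynomial degree. (A floor on the PARAMETER `d` of
the normal-form framework, whose every cost bound is monotone in `d`; not a lower bound against
arbitrary classical algorithms, and silent on BQP-hardness.) [cite: GharibianLegall2022, §1
footnote (Frobenius-norm dependence of the dequantized algorithms, "small when the rank is
small" — here the converse regime, quantified); BakshiTang2023, §1 pp. 8–9; RudiEtAl2018, Cor 2;
ChiaEtAl2022, §3.3 Theorem 3.4; KempeEtAl2010, §2; Korneichuk1991, Prop 3.5.7 (§3.5.4)] -/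
theorem pauliSum_degree_floor (c : (ι → Pauli) → ℝ) (T : Finset (ι → Pauli))
    (hT : ∀ S, S ∉ T → c S = 0) (hF : 0 < frobNorm (pauliSum c)) {d : ℕ} {p : ℝ[X]}
    (hp : p.degree ≤ d) (h1 : ∀ y ∈ Set.Icc (-1 : ℝ) 1, |p.eval y| ≤ 1) (i j : ι → Bool)
    {γ : ℝ} (hγ : γ ≤ |p.eval ((isHermitian_pauliSum c).eigenvalues i / (2 * frobNorm (pauliSum c))) -
      p.eval ((isHermitian_pauliSum c).eigenvalues j / (2 * frobNorm (pauliSum c)))|) :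
    Real.sqrt 3 * γ * (Real.sqrt ((2 : ℝ) ^ Fintype.card ι / T.card) * ∑ S ∈ T, |c S|) ≤
      d * |(isHermitian_pauliSum c).eigenvalues i - (isHermitian_pauliSum c).eigenvalues j| := by
  have hmain := frobenius_normal_form_degree_floor (isHermitian_pauliSum c) hF hp h1 i j hγ
  have hfat := sqrt_mul_pauliOneNorm_le_frobNorm c T hT
  have hX : 0 ≤ Real.sqrt ((2 : ℝ) ^ Fintype.card ι / T.card) * ∑ S ∈ T, |c S| :=
    mul_nonneg (Real.sqrt_nonneg _) (Finset.sum_nonneg fun S _ => abs_nonneg _)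
  have h3 : 0 ≤ Real.sqrt 3 := Real.sqrt_nonneg _
  rcases le_or_gt 0 γ with hγ0 | hγ0
  · calc Real.sqrt 3 * γ * (Real.sqrt ((2 : ℝ) ^ Fintype.card ι / T.card) * ∑ S ∈ T, |c S|)
        ≤ Real.sqrt 3 * γ * frobNorm (pauliSum c) :=
          mul_le_mul_of_nonneg_left hfat (mul_nonneg h3 hγ0)
      _ ≤ d * |(isHermitian_pauliSum c).eigenvalues i - (isHermitian_pauliSum c).eigenvalues j| :=
          hmain
  · have hneg : Real.sqrt 3 * γ * (Real.sqrt ((2 : ℝ) ^ Fintype.card ι / T.card) *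
        ∑ S ∈ T, |c S|) ≤ 0 :=
      mul_nonpos_of_nonpos_of_nonneg (mul_nonpos_of_nonneg_of_nonpos h3 hγ0.le) hX
    exact hneg.trans (by positivity)

/-- **HEADLINE — relative form (`d ≥ √3·γ·√(2ⁿ/m)/ε`).** In the setting of
`pauliSum_degree_floor`, if the two eigenvalues are `ε`-close RELATIVE TO THE PAULI 1-NORM,
`|μᵢ - μⱼ| ≤ ε·Λ` with `Λ = Σ_{S∈T}|c(S)| > 0` (the energy unit of the guided-local-Hamiltonian
normalisations `‖H‖ ≤ 1 ≤ Λ`, cf. `pauliOneNorm`), then `√3 · γ · √(2ⁿ/m) ≤ d · ε`.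
[cite: GharibianLegall2022, §1 footnote; Gall2024, §2.3 ((s, κ)-decomposition, precision relative
to Σ‖Hᵢ‖); BakshiTang2023, §1 pp. 8–9; RudiEtAl2018, Cor 2; ChiaEtAl2022, §3.3 Theorem 3.4;
Korneichuk1991, Prop 3.5.7 (§3.5.4)] -/
theorem pauliSum_degree_floor_relative (c : (ι → Pauli) → ℝ) (T : Finset (ι → Pauli))
    (hT : ∀ S, S ∉ T → c S = 0) (hF : 0 < frobNorm (pauliSum c)) {d : ℕ} {p : ℝ[X]}
    (hp : p.degree ≤ d) (h1 : ∀ y ∈ Set.Icc (-1 : ℝ) 1, |p.eval y| ≤ 1) (i j : ι → Bool)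
    {γ ε : ℝ} (hγ : γ ≤ |p.eval ((isHermitian_pauliSum c).eigenvalues i / (2 * frobNorm (pauliSum c))) -
      p.eval ((isHermitian_pauliSum c).eigenvalues j / (2 * frobNorm (pauliSum c)))|)
    (hΛ : 0 < ∑ S ∈ T, |c S|)
    (hε : |(isHermitian_pauliSum c).eigenvalues i - (isHermitian_pauliSum c).eigenvalues j| ≤
      ε * ∑ S ∈ T, |c S|) :
    Real.sqrt 3 * γ * Real.sqrt ((2 : ℝ) ^ Fintype.card ι / T.card) ≤ d * ε := by
  have h := pauliSum_degree_floor c T hT hF hp h1 i j hγ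
  have h' : Real.sqrt 3 * γ * Real.sqrt ((2 : ℝ) ^ Fintype.card ι / T.card) * ∑ S ∈ T, |c S| ≤
      d * ε * ∑ S ∈ T, |c S| := by
    calc Real.sqrt 3 * γ * Real.sqrt ((2 : ℝ) ^ Fintype.card ι / T.card) * ∑ S ∈ T, |c S|
        = Real.sqrt 3 * γ * (Real.sqrt ((2 : ℝ) ^ Fintype.card ι / T.card) * ∑ S ∈ T, |c S|) := by
          ring
      _ ≤ d * |(isHermitian_pauliSum c).eigenvalues i - (isHermitian_pauliSum c).eigenvalues j| := h
      _ ≤ d * (ε * ∑ S ∈ T, |c S|) := mul_le_mul_of_nonneg_left hε (Nat.cast_nonneg d)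
      _ = d * ε * ∑ S ∈ T, |c S| := by ring
  exact le_of_mul_le_mul_right h' hΛ

/-- The Pauli 1-norm over the support: `Σ_S |c(S)| = Σ_{S∈T} |c(S)|` when `c` vanishes off `T`.
[folklore] -/
private theorem sum_abs_eq_sum_support (c : (ι → Pauli) → ℝ) (T : Finset (ι → Pauli))
    (hT : ∀ S, S ∉ T → c S = 0) : ∑ S, |c S| = ∑ S ∈ T, |c S| := by
  rw [← Finset.sum_subset (Finset.subset_univ T)]
  intro S _ hS
  simp [hT S hS]

/-- **HEADLINE — no scaling escapes.** The quantity that enters the sample thresholds of the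
shelf is the product `d · ‖A‖_F` (as `(d‖A‖_F)⁴`, cf. `SampleQuery.EvenPolySVT.even_polynomial_svt`:
`s ≥ 8φ²d⁴‖A‖_F⁴log(6/δ)/ε'²` under `‖A‖ ≤ 1`). For an `m`-term Pauli sum `H` and ANY scaling
`A = H/λ` (`λ > 0`), if a polynomial `p` (`deg p ≤ d`, `d ≥ 1`, `|p| ≤ 1` on `[-1,1]`) separates
two eigenvalues `μᵢ/λ, μⱼ/λ` of `A` by a margin `γ` while `|μᵢ − μⱼ| ≤ ε·Λ`, then
`min(½, (√3/2)·γ/ε) · √(2ⁿ/m) ≤ d · ‖H‖_F/λ = d · ‖A‖_F`.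
(Dichotomy on the scale: if `λ ≥ 2|μᵢ|, 2|μⱼ|` the two points lie in the bulk and the Bernstein
floor gives `(√3/2)(γ/ε)√(2ⁿ/m) ≤ d‖A‖_F`; otherwise `λ < 2Λ` by `abs_eigenvalue_pauliSum_le` and
already `‖A‖_F = ‖H‖_F/λ > √(2ⁿ/m)/2`.) So `(d‖A‖_F)⁴ ≥ min(1/16, 9γ⁴/(16ε⁴))·(2ⁿ/m)²` in every
normalisation: the `4ⁿ/m²` factor of `sample_threshold_floor_display` cannot be scaled away.
Same honest framing as `pauliSum_degree_floor` (a statement about the framework's parameters, not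
about all classical algorithms; BQP-hardness untouched). [cite: ChiaEtAl2022, §3.3 Theorem 3.4
(thresholds in d and ‖A‖_F); BakshiTang2023, §1 pp. 8–9 (stable-rank currency); GharibianLegall2022,
§1 footnote; RudiEtAl2018, Cor 2; Korneichuk1991, Prop 3.5.7 (§3.5.4)] -/
theorem pauliSum_no_scaling_escape (c : (ι → Pauli) → ℝ) (T : Finset (ι → Pauli))
    (hT : ∀ S, S ∉ T → c S = 0) {d : ℕ} (hd : 1 ≤ d) {p : ℝ[X]} (hp : p.degree ≤ d)
    (h1 : ∀ y ∈ Set.Icc (-1 : ℝ) 1, |p.eval y| ≤ 1) (i j : ι → Bool) {γ ε lam : ℝ}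
    (hlam : 0 < lam) (hε : 0 < ε)
    (hγ : γ ≤ |p.eval ((isHermitian_pauliSum c).eigenvalues i / lam) -
      p.eval ((isHermitian_pauliSum c).eigenvalues j / lam)|)
    (hclose : |(isHermitian_pauliSum c).eigenvalues i - (isHermitian_pauliSum c).eigenvalues j| ≤
      ε * ∑ S ∈ T, |c S|) :
    min (1 / 2) (Real.sqrt 3 / 2 * γ / ε) * Real.sqrt ((2 : ℝ) ^ Fintype.card ι / T.card) ≤
      d * (frobNorm (pauliSum c) / lam) := by
  set μ := (isHermitian_pauliSum c).eigenvalues with hμdef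
  set F := frobNorm (pauliSum c) with hFdef
  set Λ := ∑ S ∈ T, |c S| with hΛdef
  set R := Real.sqrt ((2 : ℝ) ^ Fintype.card ι / T.card) with hRdef
  have hfat : R * Λ ≤ F := sqrt_mul_pauliOneNorm_le_frobNorm c T hT
  have hR0 : 0 ≤ R := Real.sqrt_nonneg _
  have hF0 : 0 ≤ F := frobNorm_nonneg _
  have hd1 : (1 : ℝ) ≤ d := by exact_mod_cast hd
  by_cases hb : 2 * |μ i| ≤ lam ∧ 2 * |μ j| ≤ lam
  · -- bulk regime: Bernstein floor
    have hmem : ∀ k, 2 * |μ k| ≤ lam → μ k / lam ∈ Set.Icc (-(1 / 2) : ℝ) (1 / 2) := by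
      intro k hk
      have hk' := abs_le.mp (show |μ k| ≤ lam / 2 by linarith)
      constructor
      · rw [le_div_iff₀ hlam]; linarith [hk'.1]
      · rw [div_le_iff₀ hlam]; linarith [hk'.2]
    have hsep := degree_floor_of_separation hp h1 (hmem i hb.1) (hmem j hb.2) hγ
    rw [← sub_div, abs_div, abs_of_pos hlam, mul_div_assoc', le_div_iff₀ hlam] at hsep
    -- hsep : √3/2 * γ * lam ≤ d * |μ i - μ j|
    have hkey : Real.sqrt 3 / 2 * γ / ε * R * lam ≤ d * F := by
      have h1' : Real.sqrt 3 / 2 * γ * lam ≤ d * (ε * Λ) :=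
        hsep.trans (mul_le_mul_of_nonneg_left hclose (by positivity))
      -- divide by ε, multiply by R, use R Λ ≤ F
      have h2' : Real.sqrt 3 / 2 * γ / ε * lam ≤ d * Λ := by
        rw [div_mul_eq_mul_div, div_le_iff₀ hε]; linarith [h1']
      have h3' : Real.sqrt 3 / 2 * γ / ε * lam * R ≤ d * Λ * R :=
        mul_le_mul_of_nonneg_right h2' hR0
      have h4' : (d : ℝ) * Λ * R ≤ d * F := by
        rw [mul_assoc]; exact mul_le_mul_of_nonneg_left (by rw [mul_comm]; exact hfat) (by positivity)
      linarith [h3', h4']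
    calc min (1 / 2) (Real.sqrt 3 / 2 * γ / ε) * R ≤ Real.sqrt 3 / 2 * γ / ε * R :=
          mul_le_mul_of_nonneg_right (min_le_right _ _) hR0
      _ ≤ d * (F / lam) := by
          rw [mul_div_assoc', le_div_iff₀ hlam]; linarith [hkey]
  · -- edge regime: the Frobenius factor alone is exponential
    have hΛall : ∑ S, |c S| = Λ := sum_abs_eq_sum_support c T hT
    have hlt : lam < 2 * Λ := by
      rcases not_and_or.mp hb with h | h
      · have := abs_eigenvalue_pauliSum_le c i; rw [hΛall] at this; linarith [not_le.mp h]
      · have := abs_eigenvalue_pauliSum_le c j; rw [hΛall] at this; linarith [not_le.mp h]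
    -- F/lam ≥ F/(2Λ) ≥ R/2
    have hstep : R / 2 ≤ F / lam := by
      rw [div_le_div_iff₀ (by norm_num : (0:ℝ) < 2) hlam]
      nlinarith [hfat, hF0, hR0, hlt]
    calc min (1 / 2) (Real.sqrt 3 / 2 * γ / ε) * R ≤ 1 / 2 * R :=
          mul_le_mul_of_nonneg_right (min_le_left _ _) hR0
      _ = R / 2 := by ring
      _ ≤ F / lam := hstep
      _ ≤ d * (F / lam) := le_mul_of_one_le_left (by positivity) hd1

/-! ### §5 Display against the even-SVT sample thresholds -/

/-- **Display (the floor inside the sample threshold) — JUXTAPOSITION ONLY.** The normalised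
even-SVT sample threshold of the shelf has the shape `8φ²d⁴ℓ/ε'²` in the polynomial degree `d`
(the `s`-hypothesis of `SampleQuery.EvenPolySVT.even_polynomial_svt_normalised`, CGLLTW Theorem 3.4
with `‖A‖_F ≤ 1`); under the floor `d ≥ √3γ√(N/m)/ε` of `pauliSum_degree_floor_relative`
(`N = 2ⁿ`) that expression is at least `72 φ² γ⁴ N² ℓ / (m² ε⁴ ε'²)` — quadratic in `4ⁿ/m²`.
What differs from a lower bound: the threshold is a SUFFICIENT sketch size of one theorem, so
this records how large that theorem's own hypothesis becomes on `m`-term Pauli sums; it is not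
a bound on the sample complexity of any algorithm, and no query model is formalised. Pure real
arithmetic. [cite: ChiaEtAl2022, §3.3 Theorem 3.4 (s = Õ(φ²d⁴‖A‖_F⁴…/ε²) sample threshold);
this file, `pauliSum_degree_floor_relative`] -/
theorem sample_threshold_floor_display {φ γ N m ε ε' ℓ d : ℝ} (hγ : 0 ≤ γ) (hN : 0 ≤ N)
    (hm : 0 < m) (hε : 0 < ε) (hℓ : 0 ≤ ℓ)
    (hd : Real.sqrt 3 * γ * Real.sqrt (N / m) / ε ≤ d) :
    72 * φ ^ 2 * γ ^ 4 * N ^ 2 * ℓ / (m ^ 2 * ε ^ 4 * ε' ^ 2) ≤ 8 * φ ^ 2 * d ^ 4 * ℓ / ε' ^ 2 := by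
  have hD0 : 0 ≤ Real.sqrt 3 * γ * Real.sqrt (N / m) / ε := by positivity
  have hD4 : (Real.sqrt 3 * γ * Real.sqrt (N / m) / ε) ^ 4 ≤ d ^ 4 := pow_le_pow_left₀ hD0 hd 4
  have hs3 : Real.sqrt 3 ^ 4 = 9 := by
    rw [show (4:ℕ) = 2 * 2 by norm_num, pow_mul, Real.sq_sqrt (by norm_num : (0:ℝ) ≤ 3)]; norm_num
  have hsN : Real.sqrt (N / m) ^ 4 = N ^ 2 / m ^ 2 := by
    rw [show (4:ℕ) = 2 * 2 by norm_num, pow_mul, Real.sq_sqrt (by positivity), div_pow]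
  have hD4' : (Real.sqrt 3 * γ * Real.sqrt (N / m) / ε) ^ 4 = 9 * γ ^ 4 * N ^ 2 / (m ^ 2 * ε ^ 4) := by
    rw [div_pow, mul_pow, mul_pow, hs3, hsN]; field_simp
  rw [hD4'] at hD4
  -- multiply `9γ⁴N²/(m²ε⁴) ≤ d⁴` by the nonnegative factor `8φ²ℓ/ε'²`
  have hfac : 0 ≤ 8 * φ ^ 2 * ℓ / ε' ^ 2 := by positivity
  have := mul_le_mul_of_nonneg_left hD4 hfac
  calc 72 * φ ^ 2 * γ ^ 4 * N ^ 2 * ℓ / (m ^ 2 * ε ^ 4 * ε' ^ 2)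
      = 8 * φ ^ 2 * ℓ / ε' ^ 2 * (9 * γ ^ 4 * N ^ 2 / (m ^ 2 * ε ^ 4)) := by ring
    _ ≤ 8 * φ ^ 2 * ℓ / ε' ^ 2 * d ^ 4 := this
    _ = 8 * φ ^ 2 * d ^ 4 * ℓ / ε' ^ 2 := by ring

end PauliSumResidue

end Literature.Computability.QuantumComplexity
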